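import Literature.AnabelianGeometry.EtaleTheta.Discharge.Sec5VocabRecordsNonVacuity
import Literature.AnabelianGeometry.EtaleTheta.FrobenioidCyclotomicRigidityToy

/-!
# [EtTh] Prop. 5.3: the record `DivisorPrimeData` is EMPTY at the closed toy §5 datum (NV census instance)

Mochizuki, *The étale theta function …*, Publ. RIMS **45** (2009), Prop. 5.3 p.325 (PDF p.99)
[cite: MochizukiEtTh2009, Prop 5.3 p.325 (PDF p.99)].  abc-iut cell, NV-L2 row `FrobenioidThetaDivisors.DivisorPrimeData`
(seat abc-iut-w5-d034), sequel of `Sec5VocabRecordsNonVacuity.lean` (p425641: the record needs infinitely many primes of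
`Φ(A_⊚)`).  Since then the FIRST closed `ThetaFrobenioid` term landed — abc-iut-f-118's toy `CyclotomicRigidityToy.toy n s`
(`FrobenioidCyclotomicRigidityToy.lean`, p430069), whose divisor monoids are `PUnit`.  A one-element monoid has NO primes
(a primary element is `≠ 1`), so the criterion applies: `DivisorPrimeData (toy n s)` is EMPTY.  PROOF-ONLY; the census class
of the row is thereby witnessed at an actual closed term («needs the GENUINE divisor monoid of `Ÿ_∞`»).  Nothing about [EtTh]
itself; no side taken on [IUTchIII] Cor. 3.12.
-/

namespace Literature.AnabelianGeometry.EtaleTheta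

open Literature.AlgebraicGeometry.Frobenioids

/-- A monoid with one element has no primary elements, hence no primes ([FrdI] §0 p.12: a primary element is `≠ 1`).
[cite: MochizukiFrdI2008, §0 p.12] -/
theorem isEmpty_primes_of_subsingleton (M : Type*) [CommMonoid M] [Subsingleton M] : IsEmpty (Primes M) := by
  refine ⟨fun 𝔭 => ?_⟩
  induction 𝔭 using Quotient.inductionOn with
  | h a => exact a.2.1 (Subsingleton.elim _ _)

namespace CyclotomicRigidityToy

/-- **`DivisorPrimeData` is EMPTY at the closed toy §5 datum `toy n s`** (its divisor monoid `Φ(A_⊚) = PUnit` has no prime,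
while the record forces infinitely many of both kinds, `isEmpty_divisorPrimeData_of_finite`).
[cite: MochizukiEtTh2009, Prop 5.3 p.325 (PDF p.99)] -/
theorem isEmpty_divisorPrimeData_toy (n : ℕ+)
    (s : CategoryTheory.Aut (CategoryTheory.SingleObj.star (Gn n)) →*
      CategoryTheory.Aut (CategoryTheory.SingleObj.star (Gn n × Gn n))) :
    IsEmpty (FrobenioidThetaDivisors.DivisorPrimeData (toy n s)) := by
  haveI : Subsingleton (toy n s).PhiAcirc := inferInstanceAs (Subsingleton PUnit)
  haveI : IsEmpty (Primes (toy n s).PhiAcirc) := isEmpty_primes_of_subsingleton _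
  exact FrobenioidThetaDivisors.isEmpty_divisorPrimeData_of_finite

end CyclotomicRigidityToy

end Literature.AnabelianGeometry.EtaleTheta
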